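import Mathlib
import Literature.NumberTheory.Transcendental.PeriodsWave0
import HarnessLib

/-!
# Baker's theorem on linear forms in logarithms — the architecture of Baker's proof

Trunk T-TRANSCEND (`Literature/NumberTheory/Transcendental`), family `periods`, fact
`Literature.NumberTheory.Transcendental.baker` (**periods.S13**, stated in `PeriodsWave0.lean`).

Source: A. Baker, *Transcendental Number Theory* (Cambridge, 1975), Chapter 2, pp. 17–27
[Baker1975]. Theorem 2.1 (p. 17): *if `α₁, …, αₙ` are non-zero algebraic numbers such that
`log α₁, …, log αₙ` (any fixed determinations) are linearly independent over the rationals, then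
`1, log α₁, …, log αₙ` are linearly independent over the field of all algebraic numbers.*
The Lean fact `Literature.NumberTheory.Transcendental.baker` is this statement for an arbitrary index type; the two agree
because linear independence is finitary (`baker_iff_bakerFin` below).

The printed proof (Ch. 2 §§3–5) has the following architecture, which this file begins to vendor
bottom-up (the goal being a sorry-free `baker_holds`):

* §3, p. 19 — reduction to the normal form (1): a nontrivial `ℚ̄`-relation
  `β₀ + β₁ log α₁ + ⋯ + βₙ log αₙ = 0` may be normalised to `βₙ = -1`, i.e.
  `β₀ + β₁ log α₁ + ⋯ + β_{n-1} log α_{n-1} = log αₙ`. Here: `Baker1975.NormalForm` (the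
  assertion that (1) is impossible) and the proved reduction `bakerFin_of_normalForm`.
* Lemma 1, p. 20 — Siegel's lemma with the bound `(NU)^{M/(N-M)}`. Here: `Baker1975.lemma1`,
  **proved** from Mathlib's `Int.Matrix.exists_ne_zero_int_vec_norm_le`.
* Lemma 2, p. 21 — the auxiliary function `Φ(z₀,…,z_{n-1})` with integer coefficients
  `|p(λ)| ≤ e^{h²}` whose mixed partials of order `≤ h²` vanish at `(l,…,l)`, `1 ≤ l ≤ h`.
* Lemma 3, p. 22 — growth bound `|f(z)| ≤ c₅^{h²+L|z|}` and the norm ("Liouville") lower bound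
  `f(l) = 0 ∨ |f(l)| > c₆^{-h²-Ll}`.
* Lemma 4, p. 23 — the extrapolation induction on `J ≤ (8n)²` (maximum modulus principle).
* Lemma 5, p. 24 — `|φ_j(0)| < exp(-h^{8n})` for `j ≤ h^{8n}` (Cauchy's formula).
* Lemma 6, p. 24 — `|t₁ log α₁ + ⋯ + tₙ log αₙ| > c₁₁^{-T}` for integers `tᵢ`, not all zero,
  `|tᵢ| ≤ T`. Here: named fact `Baker1975.Lemma6`.
* Lemma 7, p. 25 — the augmentative (Hermite interpolation) polynomial `W` of degree `< RS` with
  coefficients at most `(8σ/ρ)^{RS}`. Here: named fact `Baker1975.Lemma7`.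
* §5, p. 26 — the Vandermonde-type conclusion `0 ≤ log RS + c₁₇ h^{2n+4} - h^{8n}`, absurd.

Lemmas 2–5 depend on the data of the normal form and on the parameter `h`; they are to be
vendored in a sequel once the closed form of the partial derivatives of `Φ` (eq. (5), p. 21) is set
up. Nothing in this file weakens `Literature.NumberTheory.Transcendental.baker`.

Mathlib has Siegel's lemma (`Mathlib/NumberTheory/SiegelsLemma.lean`), the analytic part of
Lindemann–Weierstrass, and Liouville numbers; it has no Gelfond–Schneider or Baker-type result
(searched `Gelfond`, `Baker`, `linear form` in `NumberTheory`).

## References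

* [Baker1975] A. Baker, *Transcendental Number Theory*, Cambridge Univ. Press, 1975
  (doi:10.1017/cbo9780511565977), Ch. 2, Theorem 2.1 and Lemmas 1–7.
* [Baker1966] A. Baker, *Linear forms in the logarithms of algebraic numbers I, II, III*,
  Mathematika 13 (1966), 204–216; 14 (1967), 102–107, 220–228.
-/

noncomputable section

open Complex Polynomial

universe u

namespace Literature.NumberTheory.Transcendental

/-! ### Theorem 2.1 in its printed (finitely indexed) form -/

/-- **Baker's theorem, printed form** (Baker 1975, Theorem 2.1, p. 17): for finitely many complex
numbers `l₁, …, lₙ` with `e^{lᵢ}` algebraic (i.e. the `lᵢ` are determinations of logarithms of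
non-zero algebraic numbers) and `l₁, …, lₙ` linearly independent over `ℚ`, the family
`1, l₁, …, lₙ` (indexed by `Option (Fin n)`, `none ↦ 1`) is linearly independent over the field
`ℚ̄ = algebraicClosure ℚ ℂ` of all algebraic numbers. This is `Literature.NumberTheory.Transcendental.baker` restricted to the
index types `Fin n`; the two are equivalent (`baker_iff_bakerFin`). [cite: Baker1975, Theorem 2.1] -/
def bakerFin : Prop :=
  ∀ (n : ℕ) (l : Fin n → ℂ), (∀ i, IsAlgebraic ℚ (cexp (l i))) → LinearIndependent ℚ l →
    LinearIndependent (algebraicClosure ℚ ℂ) fun o : Option (Fin n) => o.elim 1 l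

/-- `baker` (at universe `0`) specialises to its finitely indexed form. [folklore] -/
theorem bakerFin_of_baker (h : baker.{0}) : bakerFin :=
  fun _n l halg hli => h l halg hli

/-- **Finitary reduction**: the finitely indexed Theorem 2.1 implies `Literature.NumberTheory.Transcendental.baker` for index
types in any universe, because a linear relation involves only finitely many vectors. [folklore] -/
theorem baker_of_bakerFin (h : bakerFin) : baker.{u} := by
  intro ι l halg hli
  classical
  -- the finite pieces: for every finite set `t` of indices, `1 ∪ l '' t` is `ℚ̄`-independent
  have key : ∀ t : Finset ι,
      LinearIndependent (algebraicClosure ℚ ℂ) (l ∘ ((↑) : t → ι)) ∧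
        (1 : ℂ) ∉ Submodule.span (algebraicClosure ℚ ℂ) (l '' (t : Set ι)) := by
    intro t
    set e := t.equivFin
    set f : Fin t.card → ι := fun k => ((e.symm k : t) : ι) with hf
    have hfinj : Function.Injective f :=
      Subtype.val_injective.comp e.symm.injective
    have hfin := h t.card (l ∘ f) (fun i => halg _) (hli.comp f hfinj)
    rw [linearIndependent_option] at hfin
    obtain ⟨h1, h2⟩ := hfin
    have hcomp : ((fun o : Option (Fin t.card) => o.elim (1 : ℂ) (l ∘ f)) ∘
        ((↑) : Fin t.card → Option (Fin t.card))) = (l ∘ ((↑) : t → ι)) ∘ e.symm := by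
      funext k; rfl
    rw [hcomp] at h1 h2
    refine ⟨(linearIndependent_equiv e.symm).mp h1, ?_⟩
    have hr : Set.range ((l ∘ ((↑) : t → ι)) ∘ e.symm) = l '' (t : Set ι) := by
      rw [Set.range_comp, e.symm.surjective.range_eq, Set.image_univ, Set.range_comp,
        Subtype.range_coe_subtype, Finset.setOf_mem]
    simpa [hr] using h2
  rw [linearIndependent_option]
  refine ⟨linearIndependent_iff_finset_linearIndependent.mpr fun t => (key t).1, ?_⟩
  intro hmem
  obtain ⟨T, hT, h1⟩ := Submodule.mem_span_finite_of_mem_span hmem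
  have hT' : (T : Set ℂ) ⊆ l '' Set.univ := by
    rw [Set.image_univ]; exact hT
  obtain ⟨t, -, rfl⟩ := Finset.subset_set_image_iff.mp hT'
  exact (key t).2 (by simpa using h1)

/-- `Literature.NumberTheory.Transcendental.baker` (any universe) is equivalent to the printed, finitely indexed Theorem 2.1.
[folklore] -/
theorem baker_iff_bakerFin : baker.{u} ↔ bakerFin := by
  refine ⟨fun h => ?_, baker_of_bakerFin⟩
  -- go through universe `u` copies of `Fin n`
  intro n l halg hli
  have h' := h (l ∘ (Equiv.ulift : ULift.{u} (Fin n) ≃ Fin n)) (fun i => halg _)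
    (hli.comp _ Equiv.ulift.injective)
  have hcomp : (fun o : Option (ULift.{u} (Fin n)) => o.elim (1 : ℂ) (l ∘ Equiv.ulift)) =
      (fun o : Option (Fin n) => o.elim (1 : ℂ) l) ∘ Option.map Equiv.ulift := by
    funext o; cases o <;> rfl
  rw [hcomp] at h'
  exact (linearIndependent_equiv
    (Equiv.optionCongr (Equiv.ulift : ULift.{u} (Fin n) ≃ Fin n))).mp h'

namespace Baker1975

/-! ### §3: the normal form (1) -/

/-- **Normal form of a counterexample** (Baker 1975, Ch. 2 §3, eq. (1), p. 19), stated as its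
impossibility: there are no complex numbers `l₀, …, lₙ` with every `e^{lᵢ}` algebraic and
`l₀, …, lₙ` linearly independent over `ℚ`, and algebraic numbers `β₀', β₀, …, β_{n-1}` with
`β₀' + β₀ l₀ + ⋯ + β_{n-1} l_{n-1} = lₙ`, i.e. `e^{β₀'} α₀^{β₀} ⋯ α_{n-1}^{β_{n-1}} = αₙ`.
(Baker indexes the logarithms `1, …, n`; here they are `Fin (n + 1)`, the distinguished one being
`Fin.last n`.) Baker's proof of Theorem 2.1 is a proof of this statement (Lemmas 2–7 and §5);
Theorem 2.1 follows from it by `bakerFin_of_normalForm`. [cite: Baker1975, Ch. 2 §3, eq. (1)] -/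
def NormalForm : Prop :=
  ∀ (n : ℕ) (l : Fin (n + 1) → ℂ), (∀ i, IsAlgebraic ℚ (cexp (l i))) → LinearIndependent ℚ l →
    ∀ (β₀ : ℂ) (β : Fin n → ℂ), IsAlgebraic ℚ β₀ → (∀ i, IsAlgebraic ℚ (β i)) →
      β₀ + ∑ i, β i * l (Fin.castSucc i) ≠ l (Fin.last n)

/-- **Reduction to the normal form** (Baker 1975, Ch. 2 §3, p. 19): if no normalised relation (1)
exists then Theorem 2.1 holds. Given a nontrivial `ℚ̄`-relation `β* · 1 + ∑ βᵢ lᵢ = 0`, some `βᵢ`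
with `i` an index of a logarithm is non-zero (otherwise `β* = 0` too); moving that index to the
last place and dividing by `-βᵢ` gives (1). [cite: Baker1975, Ch. 2 §3] -/
theorem bakerFin_of_normalForm (h : NormalForm) : bakerFin := by
  classical
  intro n l halg hli
  by_contra hnot
  obtain ⟨g, hsum, o₀, ho₀⟩ := Fintype.not_linearIndependent_iff.mp hnot
  rw [Fintype.sum_option] at hsum
  simp only [Option.elim_none, Option.elim_some] at hsum
  -- some coefficient of a logarithm is non-zero
  obtain ⟨i₀, hi₀⟩ : ∃ i, g (some i) ≠ 0 := by
    by_contra! hall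
    have hnone : g none = 0 := by
      have : g none • (1 : ℂ) = 0 := by simpa [hall] using hsum
      simpa using this
    cases o₀ with
    | none => exact ho₀ hnone
    | some i => exact ho₀ (hall i)
  -- reindex so that `i₀` becomes the last index
  obtain ⟨m, rfl⟩ : ∃ m, n = m + 1 := ⟨n - 1, by have := i₀.pos; omega⟩
  set e : Equiv.Perm (Fin (m + 1)) := Equiv.swap i₀ (Fin.last m) with he
  have hel : e (Fin.last m) = i₀ := by simp [he, Equiv.swap_apply_right]
  set l' : Fin (m + 1) → ℂ := l ∘ e with hl'
  have halg' : ∀ i, IsAlgebraic ℚ (cexp (l' i)) := fun i => halg _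
  have hli' : LinearIndependent ℚ l' := hli.comp _ e.injective
  -- the normalised coefficients
  set c : ℂ := ((g (some i₀) : algebraicClosure ℚ ℂ) : ℂ) with hc
  have hc0 : c ≠ 0 := by
    simpa [hc] using hi₀
  set β₀ : ℂ := -(((g none : algebraicClosure ℚ ℂ) : ℂ) / c) with hβ₀
  set β : Fin m → ℂ := fun j => -(((g (some (e (Fin.castSucc j))) : algebraicClosure ℚ ℂ) : ℂ) / c)
    with hβ
  have memK : ∀ x : algebraicClosure ℚ ℂ, IsAlgebraic ℚ (x : ℂ) := fun x =>
    mem_algebraicClosure_iff.mp x.2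
  have hcalg : IsAlgebraic ℚ c := memK _
  have hβ₀alg : IsAlgebraic ℚ β₀ := ((memK _).mul hcalg.inv).neg
  have hβalg : ∀ j, IsAlgebraic ℚ (β j) := fun j => ((memK _).mul hcalg.inv).neg
  refine h m l' halg' hli' β₀ β hβ₀alg hβalg ?_
  -- the relation, rewritten
  have hsum' : ((g none : algebraicClosure ℚ ℂ) : ℂ) +
      ∑ i, ((g (some i) : algebraicClosure ℚ ℂ) : ℂ) * l i = 0 := by
    simpa [IntermediateField.smul_def, smul_eq_mul] using hsum
  have hreindex : ∑ i, ((g (some i) : algebraicClosure ℚ ℂ) : ℂ) * l i =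
      ∑ j : Fin m, ((g (some (e (Fin.castSucc j))) : algebraicClosure ℚ ℂ) : ℂ) *
        l' (Fin.castSucc j) + c * l' (Fin.last m) := by
    rw [← Equiv.sum_comp e (fun i => ((g (some i) : algebraicClosure ℚ ℂ) : ℂ) * l i),
      Fin.sum_univ_castSucc, hel]
    simp [hl', hc, hel]
  rw [hreindex] at hsum'
  set S : ℂ := ∑ j : Fin m, ((g (some (e (Fin.castSucc j))) : algebraicClosure ℚ ℂ) : ℂ) *
    l' (Fin.castSucc j) with hS
  have hL : l' (Fin.last m) = -(((g none : algebraicClosure ℚ ℂ) : ℂ) + S) / c := by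
    rw [eq_div_iff hc0]
    linear_combination hsum'
  have hβsum : ∑ j, β j * l' (Fin.castSucc j) = -(S / c) := by
    simp only [hβ, hS, neg_mul, div_mul_eq_mul_div, Finset.sum_neg_distrib, Finset.sum_div]
  rw [hβsum, hL, hβ₀]
  ring

/-- **Theorem 2.1 from the impossibility of the normal form**, for `Literature.NumberTheory.Transcendental.baker` itself.
[cite: Baker1975, Ch. 2 §3] -/
theorem baker_of_normalForm (h : NormalForm) : baker.{u} :=
  baker_of_bakerFin (bakerFin_of_normalForm h)

/-! ### Lemma 1: Siegel's lemma -/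

/-- **Baker 1975, Ch. 2, Lemma 1** (Siegel's lemma, p. 20). Let `N > M > 0` be integers and
`u i j` (`i < M`, `j < N`) integers of absolute value at most `U ≥ 1`. Then there are integers
`x₁, …, x_N`, not all zero, of absolute value at most `(NU)^{M/(N-M)}`, with `∑ⱼ u i j xⱼ = 0` for
every `i`. Proved from Mathlib's `Int.Matrix.exists_ne_zero_int_vec_norm_le` (same bound).
[cite: Baker1975, Ch. 2 Lemma 1] -/
theorem lemma1 {M N : ℕ} (hM : 0 < M) (hMN : M < N) {U : ℝ} (hU : 1 ≤ U)
    (u : Fin M → Fin N → ℤ) (hu : ∀ i j, |(u i j : ℝ)| ≤ U) :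
    ∃ x : Fin N → ℤ, x ≠ 0 ∧ (∀ j, |(x j : ℝ)| ≤ (N * U) ^ ((M : ℝ) / (N - M))) ∧
      ∀ i, ∑ j, u i j * x j = 0 := by
  letI : SeminormedAddCommGroup (Matrix (Fin M) (Fin N) ℤ) := Matrix.seminormedAddCommGroup
  set A : Matrix (Fin M) (Fin N) ℤ := Matrix.of u with hA
  obtain ⟨t, ht0, hAt, hnorm⟩ :=
    Int.Matrix.exists_ne_zero_int_vec_norm_le A (by simpa using hMN) (by simpa using hM)
  simp only [Fintype.card_fin] at hnorm
  have hAU : max 1 ‖A‖ ≤ U := by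
    refine max_le hU ?_
    rw [Matrix.norm_le_iff (by linarith)]
    intro i j
    simpa [hA, Int.norm_eq_abs] using hu i j
  have hexp : 0 ≤ (M : ℝ) / (N - M) := by
    apply div_nonneg (by positivity)
    have : (M : ℝ) < N := by exact_mod_cast hMN
    linarith
  refine ⟨t, ht0, fun j => ?_, fun i => ?_⟩
  · calc |(t j : ℝ)| = ‖t j‖ := (Int.norm_eq_abs _).symm
      _ ≤ ‖t‖ := norm_le_pi_norm t j
      _ ≤ (N * max 1 ‖A‖) ^ ((M : ℝ) / (N - M)) := hnorm
      _ ≤ (N * U) ^ ((M : ℝ) / (N - M)) := by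
        apply Real.rpow_le_rpow (by positivity) _ hexp
        exact mul_le_mul_of_nonneg_left hAU (by positivity)
  · have := congrFun hAt i
    simpa [Matrix.mulVec, dotProduct, hA] using this

/-! ### Lemma 6: a Liouville-type lower bound for integral linear forms in logarithms -/

/-- **Baker 1975, Ch. 2, Lemma 6** (p. 24), with the chapter's standing hypotheses made explicit:
let `l₁, …, lₙ` be determinations of logarithms of non-zero algebraic numbers (`e^{lᵢ}` algebraic)
which are linearly independent over `ℚ`. Then there is a positive number `c₁₁`, depending only on
these data, such that for any integers `t₁, …, tₙ`, not all `0`, with absolute values at most `T`,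
`|t₁ l₁ + ⋯ + tₙ lₙ| > c₁₁^{-T}`. (Proof in the source: the norm of the algebraic integer
`a₁^{|t₁|} ⋯ aₙ^{|tₙ|} (α₁^{t₁} ⋯ αₙ^{tₙ} - 1)` is a non-zero rational integer unless the form is a
non-zero multiple of `2πi`.) [cite: Baker1975, Ch. 2 Lemma 6] -/
def Lemma6 : Prop :=
  ∀ (n : ℕ) (l : Fin n → ℂ), (∀ i, IsAlgebraic ℚ (cexp (l i))) → LinearIndependent ℚ l →
    ∃ c : ℝ, 0 < c ∧ ∀ (T : ℕ) (t : Fin n → ℤ), t ≠ 0 → (∀ i, |t i| ≤ T) →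
      (c ^ T)⁻¹ < ‖∑ i, (t i : ℂ) * l i‖

/-! ### Lemma 7: the augmentative polynomial -/

/-- **Baker 1975, Ch. 2, Lemma 7** (p. 25). Let `R, S` be positive integers and `σ₀, …, σ_{R-1}`
distinct complex numbers; let `σ ≥ max(1, |σᵢ|)` and `0 < ρ ≤ min(1, |σᵢ - σⱼ| (i ≠ j))`. Then for
any `r < R`, `s < S` there is a polynomial `W(z) = ∑_{j<RS} wⱼ zʲ` with `|wⱼ| ≤ (8σ/ρ)^{RS}` such
that `W^{(j)}(σᵢ) = 0` for all `i < R`, `j < S` other than `(i, j) = (r, s)`, and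
`W^{(s)}(σ_r) = 1`. (The source takes `σ`, `ρ` to be exactly the stated max and min; since the
bound is monotone in `σ` and antitone in `ρ`, quantifying over upper/lower bounds `σ`, `ρ` as here
is equivalent.) [cite: Baker1975, Ch. 2 Lemma 7] -/
def Lemma7 : Prop :=
  ∀ (R S : ℕ) (σ : Fin R → ℂ), Function.Injective σ →
    ∀ (σM ρ : ℝ), 1 ≤ σM → (∀ i, ‖σ i‖ ≤ σM) → 0 < ρ → ρ ≤ 1 →
      (∀ i j, i ≠ j → ρ ≤ ‖σ i - σ j‖) →
    ∀ (r : Fin R) (s : Fin S),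
      ∃ W : ℂ[X], W.degree < (R * S : ℕ) ∧
        (∀ j, ‖W.coeff j‖ ≤ (8 * σM / ρ) ^ (R * S)) ∧
        ∀ (i : Fin R) (j : Fin S),
          (derivative^[j] W).eval (σ i) = if i = r ∧ j = s then 1 else 0

end Baker1975

end Literature.NumberTheory.Transcendental
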